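import Summits.AtomisticToContinuum.Crystallization.Theorems.FrustratedLawDichotomyCellTflatData

/-!
# FrustratedLawDichotomy · crux `AperiodicFrustratedLawGap` (stmt-AtomisticToContinuum-27623) — T′♭₄₅ witness cell: class checks 4–7
# (decomp-a2c, prover hand 1, generation 15; kernel evaluations of `Cell.checkClassBad`, split for build time)

Each theorem is ONE `decide +kernel` of `cellT.checkClassBad m (cellTCert m)`: nn witness, far witness at `≥ 9/8·d`, the 11664-point pinning scan and
the class site-sum bound.  [folklore]
-/

namespace Summit.AtomisticToContinuum.Crystallization.Theorems.FrustratedLawDichotomyCellTflatCeiling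

open Summit.AtomisticToContinuum.Crystallization.Theorems.FrustratedLawDichotomyCellChecker


set_option maxHeartbeats 0 in
/-- Class `4` of `cellT` passes `checkClassBad` (kernel evaluation). [folklore] -/
theorem cellT_checkClass4 : cellT.checkClassBad ⟨4, by decide⟩ (cellTCert 4) = true := by decide +kernel

set_option maxHeartbeats 0 in
/-- Class `5` of `cellT` passes `checkClassBad` (kernel evaluation). [folklore] -/
theorem cellT_checkClass5 : cellT.checkClassBad ⟨5, by decide⟩ (cellTCert 5) = true := by decide +kernel

set_option maxHeartbeats 0 in
/-- Class `6` of `cellT` passes `checkClassBad` (kernel evaluation). [folklore] -/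
theorem cellT_checkClass6 : cellT.checkClassBad ⟨6, by decide⟩ (cellTCert 6) = true := by decide +kernel

set_option maxHeartbeats 0 in
/-- Class `7` of `cellT` passes `checkClassBad` (kernel evaluation). [folklore] -/
theorem cellT_checkClass7 : cellT.checkClassBad ⟨7, by decide⟩ (cellTCert 7) = true := by decide +kernel

end Summit.AtomisticToContinuum.Crystallization.Theorems.FrustratedLawDichotomyCellTflatCeiling
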